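import Mathlib
import Summits.Ventures.PercRepro.TriangleCapClosedFormArith

/-!
# PercRepro — ROW C-047 (the signed-complete cherry bound) is false: the kernel record (p3, gen 28)

ROW C-047 (P3-TRIANGLE-CAP.md §10v; RULING (um)(101)): for `k ≥ 3` and a graph `D` on the `k` vertices of
`K_k` with at most `4` edges on every `4` vertices (`K₄⁻`-free) and `m = |D| ≥ 1` edges,

  `Σ_v C(d_D(v), 2) ≤ B_k(m) := P_KK(C(k−1,2) + m − 1) − C(k,3)`,

with equality iff the edges of `D` are pairwise adjacent (a star or a triangle).  `P_KK` is the table of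
the triangle-cap lane (`KK.P`, TriangleCapClosedFormArith: `KK.P_closed`).  The row was KILLED AS STATED
on its author's witness `D = K_{3,25}` on `K₂₈` (INBOX 11885 / 11904 / 11964 / 11975: cherries `975 > 974`).

This module is the kernel record of that kill on the GRAPH side (Mathlib only):

* `cherries D = Σ_v C(deg v, 2)`, `adjPairs D S` = the ordered adjacent pairs inside `S` (`= 2·#edges`),
  `K4mFree D` = every `4`-set carries `≤ 8` ordered adjacent pairs, `B k m`, and the two clauses of the row
  as `Prop`s: `RowC047` (the inequality) and `EqClauseC047` (the equality clause);
* `bip n a` = the complete bipartite graph `K_{a, n−a}` on `Fin n` with parts `{i < a}`, `{a ≤ i}`;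
  `k4mFree_bip` — a `4`-set of a complete bipartite graph spans `≤ 2·x·(4−x) ≤ 8` ordered adjacent pairs;
  `cherries_bip` — `Σ_v C(d(v), 2) = a·C(n−a, 2) + (n−a)·C(a, 2)`; `card_edges_bip` — `a·(n−a)` edges;
* **`not_rowC047`** — on `K325 = bip 28 3 = K_{3,25}`: `cherries = 975`, `75` edges,
  `B 28 75 = 974` (`KK.P_closed` at `tri 28 + 19`: `C(30,3) + C(20,2) − C(28,3)`), so the inequality fails;
* **`not_eqClauseC047`** — on `K324 = bip 27 3 = K_{3,24}`: `cherries = 900 = B 27 72` (a tight instance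
  with `m = 72 > k − 1`), and the edges `s(0,3)`, `s(1,4)` are disjoint, so the equality clause fails.

The matroid clause of the row (`T(M(K₂₈, K_{3,25})) = 4251 > P_KK(425) = 4250`) is the two-implementation
arithmetic record of the bus (p3 `sdc.c`, engine `witness.c`, ref-2 / ref-3 re-derivations) and is not typed
here.  Axioms: standard.
-/

namespace PercRepro

namespace TriangleCap

namespace C047

open Finset

variable {V : Type*} [Fintype V]

/-- The degree of `v` as the number of neighbours in `univ` (`= D.degree v`, `deg_eq_degree`). -/
def deg (D : SimpleGraph V) [DecidableRel D.Adj] (v : V) : ℕ := (univ.filter (fun w => D.Adj v w)).card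

/-- `deg D v = D.degree v`. -/
theorem deg_eq_degree (D : SimpleGraph V) [DecidableRel D.Adj] (v : V) : deg D v = D.degree v := by
  rw [← SimpleGraph.card_neighborFinset_eq_degree, SimpleGraph.neighborFinset_eq_filter]
  rfl

/-- The cherry count `Σ_v C(d(v), 2)` (the number of paths of length two, triangles counted three times). -/
def cherries (D : SimpleGraph V) [DecidableRel D.Adj] : ℕ := ∑ v, (deg D v).choose 2

/-- The ordered adjacent pairs `(u, v) ∈ S × S` with `u ~ v` (`= 2 ·` the edges inside `S`). -/
def adjPairs (D : SimpleGraph V) [DecidableRel D.Adj] (S : Finset V) : ℕ :=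
  ((S ×ˢ S).filter (fun p => D.Adj p.1 p.2)).card

/-- `K₄⁻`-free: at most `4` edges (`8` ordered adjacent pairs) on every `4` vertices. -/
def K4mFree (D : SimpleGraph V) [DecidableRel D.Adj] : Prop :=
  ∀ S : Finset V, S.card = 4 → adjPairs D S ≤ 8

/-- The edges of `D` are pairwise adjacent (every two distinct edges share a vertex). -/
def PairwiseAdjacent [DecidableEq V] (D : SimpleGraph V) [DecidableRel D.Adj] : Prop :=
  ∀ e ∈ D.edgeFinset, ∀ f ∈ D.edgeFinset, e ≠ f → ∃ x, x ∈ e ∧ x ∈ f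

/-- The row's bound `B_k(m) = P_KK(C(k−1,2) + m − 1) − C(k,3)`. -/
def B (k m : ℕ) : ℕ := KK.P ((k - 1).choose 2 + m - 1) - k.choose 3

/-- **ROW C-047, the inequality:** for every `k ≥ 3` and every `K₄⁻`-free `D` on `Fin k` with `m ≥ 1` edges,
`Σ_v C(d_D(v), 2) ≤ B_k(m)`. -/
def RowC047 : Prop :=
  ∀ (k : ℕ), 3 ≤ k → ∀ (D : SimpleGraph (Fin k)) [DecidableRel D.Adj],
    K4mFree D → 1 ≤ D.edgeFinset.card → cherries D ≤ B k D.edgeFinset.card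

/-- **ROW C-047, the equality clause:** equality in the bound forces the edges to be pairwise adjacent. -/
def EqClauseC047 : Prop :=
  ∀ (k : ℕ), 3 ≤ k → ∀ (D : SimpleGraph (Fin k)) [DecidableRel D.Adj],
    K4mFree D → 1 ≤ D.edgeFinset.card → cherries D = B k D.edgeFinset.card → PairwiseAdjacent D

/-- The complete bipartite graph `K_{a, n−a}` on `Fin n` with parts `{i : i < a}` and `{i : a ≤ i}`. -/
def bip (n a : ℕ) : SimpleGraph (Fin n) where
  Adj i j := Xor (i.val < a) (j.val < a)
  symm := ⟨fun i j h => by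
    rcases h with ⟨h1, h2⟩ | ⟨h1, h2⟩
    · exact Or.inr ⟨h1, h2⟩
    · exact Or.inl ⟨h1, h2⟩⟩
  loopless := ⟨fun i h => by
    rcases h with ⟨h1, h2⟩ | ⟨h1, h2⟩ <;> exact h2 h1⟩

/-- Adjacency in `bip n a` is decidable (`Xor` of two decidable comparisons). -/
instance decidableRelBip (n a : ℕ) : DecidableRel (bip n a).Adj :=
  fun i j => inferInstanceAs (Decidable (Xor (i.val < a) (j.val < a)))

/-- `(bip n a).Adj i j ↔ Xor (i < a) (j < a)`. -/
theorem bip_adj (n a : ℕ) (i j : Fin n) : (bip n a).Adj i j ↔ Xor (i.val < a) (j.val < a) := Iff.rfl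

/-- The adjacent ordered pairs inside `S` lie in `(S ∩ L) × (S ∩ R) ∪ (S ∩ R) × (S ∩ L)`. -/
theorem adjPairs_bip_le (n a : ℕ) (S : Finset (Fin n)) :
    adjPairs (bip n a) S ≤
      2 * ((S.filter (fun i : Fin n => i.val < a)).card * (S.filter (fun i : Fin n => ¬ i.val < a)).card) := by
  unfold adjPairs
  set SL := S.filter (fun i : Fin n => i.val < a) with hSL
  set SR := S.filter (fun i : Fin n => ¬ i.val < a) with hSR
  have hsub : (S ×ˢ S).filter (fun p => (bip n a).Adj p.1 p.2) ⊆ SL ×ˢ SR ∪ SR ×ˢ SL := by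
    intro p hp
    rw [mem_filter, mem_product] at hp
    obtain ⟨⟨h1, h2⟩, hadj⟩ := hp
    rw [bip_adj] at hadj
    rw [mem_union, mem_product, mem_product, hSL, hSR, mem_filter, mem_filter, mem_filter, mem_filter]
    rcases hadj with ⟨hu, hv⟩ | ⟨hv, hu⟩
    · exact Or.inl ⟨⟨h1, hu⟩, ⟨h2, hv⟩⟩
    · exact Or.inr ⟨⟨h1, hu⟩, ⟨h2, hv⟩⟩
  calc ((S ×ˢ S).filter (fun p => (bip n a).Adj p.1 p.2)).card
      ≤ (SL ×ˢ SR ∪ SR ×ˢ SL).card := card_le_card hsub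
    _ ≤ (SL ×ˢ SR).card + (SR ×ˢ SL).card := card_union_le _ _
    _ = 2 * (SL.card * SR.card) := by rw [card_product, card_product]; ring

/-- A complete bipartite graph is `K₄⁻`-free: a `4`-set with `x` left vertices spans `x (4 − x) ≤ 4` edges. -/
theorem k4mFree_bip (n a : ℕ) : K4mFree (bip n a) := by
  intro S hS
  have h := adjPairs_bip_le n a S
  have hsum := card_filter_add_card_filter_not (s := S) (fun i : Fin n => i.val < a)
  rw [hS] at hsum
  set x := (S.filter (fun i : Fin n => i.val < a)).card with hx
  set y := (S.filter (fun i : Fin n => ¬ i.val < a)).card with hy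
  have hx4 : x ≤ 4 := by omega
  interval_cases x <;> omega

/-- The left part `{i : Fin n | i < a}` has `a` elements when `a ≤ n`. -/
theorem card_left (n a : ℕ) (h : a ≤ n) : (univ.filter (fun i : Fin n => i.val < a)).card = a := by
  have := Fin.card_filter_val_lt (n := n) (m := a)
  simpa [Nat.min_eq_right h] using this

/-- The right part `{i : Fin n | a ≤ i}` has `n − a` elements when `a ≤ n`. -/
theorem card_right (n a : ℕ) (h : a ≤ n) :
    (univ.filter (fun i : Fin n => ¬ i.val < a)).card = n - a := by
  have hsum := card_filter_add_card_filter_not (s := (univ : Finset (Fin n))) (fun i : Fin n => i.val < a)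
  rw [card_left n a h, card_univ, Fintype.card_fin] at hsum
  omega

/-- The neighbours of a left vertex of `K_{a, n−a}` are the right vertices. -/
theorem filter_adj_bip_of_lt (n a : ℕ) (v : Fin n) (hv : v.val < a) :
    univ.filter (fun w => (bip n a).Adj v w) = univ.filter (fun i : Fin n => ¬ i.val < a) := by
  apply filter_congr
  intro w _
  rw [bip_adj]
  constructor
  · rintro (⟨_, h2⟩ | ⟨_, h2⟩)
    · exact h2
    · exact absurd hv h2
  · intro hw
    exact Or.inl ⟨hv, hw⟩

/-- The neighbours of a right vertex of `K_{a, n−a}` are the left vertices. -/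
theorem filter_adj_bip_of_not_lt (n a : ℕ) (v : Fin n) (hv : ¬ v.val < a) :
    univ.filter (fun w => (bip n a).Adj v w) = univ.filter (fun i : Fin n => i.val < a) := by
  apply filter_congr
  intro w _
  rw [bip_adj]
  constructor
  · rintro (⟨h1, _⟩ | ⟨h1, _⟩)
    · exact absurd h1 hv
    · exact h1
  · intro hw
    exact Or.inr ⟨hw, hv⟩

/-- A left vertex of `K_{a, n−a}` has degree `n − a`. -/
theorem deg_bip_of_lt (n a : ℕ) (h : a ≤ n) (v : Fin n) (hv : v.val < a) : deg (bip n a) v = n - a := by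
  unfold deg
  rw [filter_adj_bip_of_lt n a v hv, card_right n a h]

/-- A right vertex of `K_{a, n−a}` has degree `a`. -/
theorem deg_bip_of_not_lt (n a : ℕ) (h : a ≤ n) (v : Fin n) (hv : ¬ v.val < a) : deg (bip n a) v = a := by
  unfold deg
  rw [filter_adj_bip_of_not_lt n a v hv, card_left n a h]

/-- `Σ_v C(d(v), 2) = a·C(n−a, 2) + (n−a)·C(a, 2)` on `K_{a, n−a}`. -/
theorem cherries_bip (n a : ℕ) (h : a ≤ n) :
    cherries (bip n a) = a * (n - a).choose 2 + (n - a) * a.choose 2 := by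
  unfold cherries
  rw [← sum_filter_add_sum_filter_not univ (fun i : Fin n => i.val < a)]
  have hL : ∑ v ∈ univ.filter (fun i : Fin n => i.val < a), (deg (bip n a) v).choose 2 =
      ∑ v ∈ univ.filter (fun i : Fin n => i.val < a), (n - a).choose 2 :=
    sum_congr rfl (fun v hv => by rw [deg_bip_of_lt n a h v (mem_filter.mp hv).2])
  have hR : ∑ v ∈ univ.filter (fun i : Fin n => ¬ i.val < a), (deg (bip n a) v).choose 2 =
      ∑ v ∈ univ.filter (fun i : Fin n => ¬ i.val < a), a.choose 2 :=
    sum_congr rfl (fun v hv => by rw [deg_bip_of_not_lt n a h v (mem_filter.mp hv).2])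
  rw [hL, hR, sum_const, sum_const, card_left n a h, card_right n a h, smul_eq_mul, smul_eq_mul]

/-- `Σ_v d(v) = 2·a·(n−a)` on `K_{a, n−a}`. -/
theorem sum_deg_bip (n a : ℕ) (h : a ≤ n) : ∑ v, deg (bip n a) v = 2 * (a * (n - a)) := by
  rw [← sum_filter_add_sum_filter_not univ (fun i : Fin n => i.val < a)]
  have hL : ∑ v ∈ univ.filter (fun i : Fin n => i.val < a), deg (bip n a) v =
      ∑ v ∈ univ.filter (fun i : Fin n => i.val < a), (n - a) :=
    sum_congr rfl (fun v hv => deg_bip_of_lt n a h v (mem_filter.mp hv).2)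
  have hR : ∑ v ∈ univ.filter (fun i : Fin n => ¬ i.val < a), deg (bip n a) v =
      ∑ v ∈ univ.filter (fun i : Fin n => ¬ i.val < a), a :=
    sum_congr rfl (fun v hv => deg_bip_of_not_lt n a h v (mem_filter.mp hv).2)
  rw [hL, hR, sum_const, sum_const, card_left n a h, card_right n a h, smul_eq_mul, smul_eq_mul]
  ring

/-- `K_{a, n−a}` has `a·(n−a)` edges (handshake). -/
theorem card_edges_bip (n a : ℕ) (h : a ≤ n) : (bip n a).edgeFinset.card = a * (n - a) := by
  have h1 := (bip n a).sum_degrees_eq_twice_card_edges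
  have h2 : ∑ v, (bip n a).degree v = ∑ v, deg (bip n a) v :=
    sum_congr rfl (fun v _ => (deg_eq_degree (bip n a) v).symm)
  rw [h2, sum_deg_bip n a h] at h1
  omega

/-- `K_{3,25}` on `Fin 28`: the kill witness of ROW C-047. -/
abbrev K325 : SimpleGraph (Fin 28) := bip 28 3

/-- `K_{3,24}` on `Fin 27`: the tight instance against the equality clause. -/
abbrev K324 : SimpleGraph (Fin 27) := bip 27 3

/-- `Σ_v C(d(v), 2) = 3·C(25,2) + 25·C(3,2) = 900 + 75 = 975` on `K_{3,25}`. -/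
theorem cherries_K325 : cherries K325 = 975 := by
  norm_num [cherries_bip 28 3 (by norm_num), Nat.choose_two_right]

/-- `K_{3,25}` has `75` edges. -/
theorem card_edges_K325 : K325.edgeFinset.card = 75 := by
  rw [card_edges_bip 28 3 (by norm_num)]

/-- `tri 28 = 406 = C(29,2)`. -/
theorem tri_28 : KK.tri 28 = 406 := by rw [KK.tri_eq_choose]; decide

/-- `B_28(75) = P_KK(425) − C(28,3) = C(30,3) + C(20,2) − C(28,3) = 4060 + 190 − 3276 = 974`. -/
theorem B_28_75 : B 28 75 = 974 := by
  have h1 : (28 - 1 : ℕ).choose 2 + 75 - 1 = KK.tri 28 + 19 := by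
    rw [tri_28, Nat.choose_two_right]
  unfold B
  rw [h1, KK.P_closed 28 19 (by norm_num)]
  decide

/-- **ROW C-047 IS FALSE:** on `K_{3,25} ⊂ K₂₈` (`K₄⁻`-free, `75` edges) the cherry count `975` exceeds
`B_28(75) = 974`. -/
theorem not_rowC047 : ¬ RowC047 := by
  intro h
  have := h 28 (by norm_num) K325 (k4mFree_bip 28 3) (by rw [card_edges_K325]; norm_num)
  rw [card_edges_K325, cherries_K325, B_28_75] at this
  omega

/-- `Σ_v C(d(v), 2) = 3·C(24,2) + 24·C(3,2) = 828 + 72 = 900` on `K_{3,24}`. -/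
theorem cherries_K324 : cherries K324 = 900 := by
  norm_num [cherries_bip 27 3 (by norm_num), Nat.choose_two_right]

/-- `K_{3,24}` has `72` edges. -/
theorem card_edges_K324 : K324.edgeFinset.card = 72 := by
  rw [card_edges_bip 27 3 (by norm_num)]

/-- `tri 27 = 378 = C(28,2)`. -/
theorem tri_27 : KK.tri 27 = 378 := by rw [KK.tri_eq_choose]; decide

/-- `B_27(72) = P_KK(396) − C(27,3) = C(29,3) + C(19,2) − C(27,3) = 3654 + 171 − 2925 = 900`. -/
theorem B_27_72 : B 27 72 = 900 := by
  have h1 : (27 - 1 : ℕ).choose 2 + 72 - 1 = KK.tri 27 + 18 := by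
    rw [tri_27, Nat.choose_two_right]
  unfold B
  rw [h1, KK.P_closed 27 18 (by norm_num)]
  decide

/-- **THE EQUALITY CLAUSE OF ROW C-047 IS FALSE:** `K_{3,24} ⊂ K₂₇` is tight (`900 = B_27(72)`, with
`72 > 26` edges) and its edges `s(0,3)`, `s(1,4)` are disjoint. -/
theorem not_eqClauseC047 : ¬ EqClauseC047 := by
  intro h
  have hpa := h 27 (by norm_num) K324 (k4mFree_bip 27 3) (by rw [card_edges_K324]; norm_num)
    (by rw [card_edges_K324, cherries_K324, B_27_72])
  have e1 : s((0 : Fin 27), (3 : Fin 27)) ∈ K324.edgeFinset := by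
    rw [SimpleGraph.mem_edgeFinset, SimpleGraph.mem_edgeSet]
    decide
  have e2 : s((1 : Fin 27), (4 : Fin 27)) ∈ K324.edgeFinset := by
    rw [SimpleGraph.mem_edgeFinset, SimpleGraph.mem_edgeSet]
    decide
  have hne : s((0 : Fin 27), (3 : Fin 27)) ≠ s((1 : Fin 27), (4 : Fin 27)) := by
    intro heq
    rw [Sym2.eq_iff] at heq
    rcases heq with ⟨h1, _⟩ | ⟨h1, _⟩ <;> exact absurd h1 (by decide)
  obtain ⟨x, hx1, hx2⟩ := hpa _ e1 _ e2 hne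
  rw [Sym2.mem_iff] at hx1 hx2
  rcases hx1 with rfl | rfl <;> rcases hx2 with h | h <;> exact absurd h (by decide)

end C047

end TriangleCap

end PercRepro
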